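import Summits.QuantumFields.YangMills.Theorems.BalabanUVNodesN15KingModelDressedJetCovariantSupCarrier
import Summits.QuantumFields.YangMills.Theorems.BalabanUVNodesN15KingModelSrcDivJet
import HarnessLib

/-!
# N15 (NE2) — THE KING-MODEL RUNG, FILE 71 = K-L, `…KingModelSrcDivKnitAllEntries` (the knit dag-n15-a g26 named «YOURS», INBOX l.43391): ★★★ `T4EtaRate.NE2PlusOperator` BY NAME, HYPOTHESIS-FREE, FOR KING's FULL `A = 0`
# PROPAGATOR `⊗ 1` DRESSED BY THE FIRST-ORDER SPECIES ON THE (3.35)-PAIR CARRIER — ALL FOUR ENTRIES OF THE (3.42) JET BACKGROUND-LIVE: 0 (value), 1 (dressed gradient), 2 (THE DRESSED SOURCE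
# DIVERGENCE `X∘N∇*_κ`, this seat's programme Y ★★★ `hasMaj_idef_srcDivJet_king`), 3 (dressed covariant Laplacian)

WHO ∕ WHEN.  Cell `pub-ymgap`, seat `pub-ymgap-dag-n15-d` (R134, N15 NE2 s3 = King-model rung, g22); `--kind proof --supports stmt-QuantumFields-27366 --as helper` (K3⁸;
count-neutral).  One plumbing `def` (`foKingFamilyAll`, the shape of dag-n15-a K-D's `foKingFamilyCov` with entry 2 replaced) + theorems.  Over dag-n15-a K-D `…KingModelDressedJetCovariantSupCarrier`
∕ `…KingModelDressedJetCovariant` (`foKingInstance` via K-C, ★★★ `hasMaj_idef_covLapJet_king`, `levelCount_rate_le`), K-B (★★ `hasMaj_projO_idef_bgPair_kingJet`), this seat's FILE 70e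
`…KingModelSrcDivJet` (★★★ `hasMaj_idef_srcDivJet_king`), II-E (`coeffBgFO`, `reg335_coeffBgFO_iff`, `foOps`, `osc_rate_le`), n15-b (`one_le_pref4`, `projO`, `bgPair`, `unstack`, `fibreOsc_of_fgrad`),
g0 `etaRateIneq342_of_hasMaj_rateWeight`, `T4EtaRateCoeffDefect.fit_blockAvg` BY NAME; the proof is K-D's §16 verbatim with the entry-2 branch replaced; nothing in the tree is modified.

WHAT.  §1 `levelCount_le_rpow` (`K + 2 ≤ (p⁻¹ + 2)(L^K)^p` for `L ≥ 3`, `p > 0` — absorbs the entry-2 logarithm into any positive rate), `srcDivEntry_rate_le`.  §2 `foKingFamilyAll a ν κ` = K-D's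
family with ENTRY 2 := `𝔇_{kingPrV}(X′∘N′∇′*_κ, X̄∘N̄∇̄*_κ)`, `X = (bgPair (A₀⁻¹⊗1) (N∇_μ(A₀⁻¹⊗1))_μ c a)_none` the dressed propagator of n15-b's (3.65) fixed point — BACKGROUND-LIVE at both spacings
(coarse partner at the block-averaged letters).  §3 ★★★ `ne2PlusOperator_kingJet_allEntries (hd : 1 ≤ d) (hLodd) (hL : 2 ≤ L) (ha) (hm0) (c₃₅) (hc₃₅) (ν κ) :
NE2PlusOperator c₃₅ (foKingInstance d L) (foKingFamilyAll d L a ν κ)` — HYPOTHESIS-FREE (`M₅ = 1`, `a₀ = r₀∕c₃₅`, King's `γ = ½`, common rate number `(L^K)^{−1∕(32(d+1))}`: the entry-2 row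
`B(K+2)((L^K)^{−1∕4} + r(L^K)^{−1∕(8(d+1))})` and the entries 0∕1∕3 rows `(L^K)^{−1∕4}` absorbed by §1); ★★ `ne2ZeroOperator_kingJet_allEntries`; `_dim4`.

HONEST FRAMING ∕ LIMITS.  All four entries carry the configuration genuinely, but in King's `A = 0` MODEL with the abelianised scalar-multiplier species of (3.52)'s `V′(A)` and the
block-averaged coarse partner (C3) (template literature [King1986] (2.13)–(2.17) p.653, (4.1)–(4.5) p.670, (4.36) p.674; [Balaban1985BackgroundPropagators] Thm 3.1 (3.42) p.397: SHAPES) —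
NOT Bałaban's covariant `G(U)` ((S3) located).  NE2⁺ as printed NOT PRINTED ∕ NOT proved; no statement of record touched; N15 NOT discharged; K3⁸ OPEN; counts UNMOVED (typed 28∕28 ·
discharged 6∕28 of record, = 6∕27 excl. NODE O); one finite torus per index — NOT ℝ⁴ ∕ infinite volume ∕ OS ∕ mass gap ∕ Clay.  ONE declared `set_option maxHeartbeats 1600000 in` on ★★★ (as K-D: the family is a long term).
-/
noncomputable section

open scoped BigOperators
open Finset

namespace Summit.QuantumFields.YangMills.BalabanUVNodes.N15.KingModel.SrcDiv

open Literature.MathematicalPhysics.QuantumFieldTheory.Balaban1983to89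
open Literature.MathematicalPhysics.QuantumFieldTheory.Balaban1983to89.B11SectG (BlockNorm HasMaj)
open Literature.MathematicalPhysics.QuantumFieldTheory.Balaban1983to89.T4EtaRate (PairedInstance EtaPairing EtaRateIneq342 NE2PlusOperator NE2ZeroOperator ne2Zero_of_ne2Plus)
open Literature.MathematicalPhysics.QuantumFieldTheory.Balaban1983to89.T4EtaRateDefect (idef rateWeight)
open Literature.MathematicalPhysics.QuantumFieldTheory.Balaban1983to89.T4EtaRateCoeffDefect (pull blockAvg fit_blockAvg)
open Literature.MathematicalPhysics.QuantumFieldTheory.Balaban1983to89.B5Prop11Plancherel (Tor fine unitVec)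
open Literature.MathematicalPhysics.QuantumFieldTheory.King1986.Torus (blockOf tdistT tdistT_nonneg)
open Literature.MathematicalPhysics.QuantumFieldTheory.Balaban1983to89.B6UnitTorusCarrier (unitTorusGeo)
open Summit.QuantumFields.YangMills.BalabanUVNodes.N15.VectorPiece (blkFine kingPrV blkFine_comp_kingPrV unitTorusGeoS rateWeight_unitTorusGeoS tensorId bshiftEquiv)
open Summit.QuantumFields.YangMills.BalabanUVNodes.N15.OperatorReadout (opGeo opFamily opGeo_len etaRateIneq342_of_hasMaj_rateWeight)
open Summit.QuantumFields.YangMills.BalabanUVNodes.N15.BackgroundLayer (bgPair projO unstack fineGeo one_le_pref4 fgrad fgrad_apply fibreOsc_of_fgrad)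
open Summit.QuantumFields.YangMills.BalabanUVNodes.N15KingModelRung.Curved (kingGOp kingSOp kingLapOp EtaLatIdx)
open Summit.QuantumFields.YangMills.BalabanUVNodes.N15.TwoGrid (symbOp sD sTinv coeffBgFO reg335_coeffBgFO_iff foOps osc_rate_le)
open Summit.QuantumFields.YangMills.BalabanUVNodes.N15.TwoGrid.KingJet (foKingInstance foKingInstance_gf_M levelCount_rate_le hasMaj_projO_idef_bgPair_kingJet hasMaj_idef_covLapJet_king)

variable {d : ℕ}

/-! ## §1 The entry-2 logarithm against a positive rate -/

section Rates

/-- `K + 2 ≤ (p⁻¹ + 2)·(L^K)^p` for `L ≥ 3`, `p > 0` (`(L^K)^p = e^{pK log L} ≥ 1 + pK`, `log L ≥ 1`). [folklore] -/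
theorem levelCount_le_rpow {L : ℕ} (hL : 3 ≤ L) {p : ℝ} (hp : 0 < p) (K : ℕ) : ((K : ℕ) : ℝ) + 2 ≤ (p⁻¹ + 2) * ((L : ℝ) ^ K) ^ p := by
  have hLr : (3 : ℝ) ≤ (L : ℝ) := by exact_mod_cast hL
  have hL0 : (0 : ℝ) < (L : ℝ) := by linarith
  have hlog : 1 ≤ Real.log (L : ℝ) := by
    rw [Real.le_log_iff_exp_le (by positivity)]
    exact (Real.exp_one_lt_d9.le.trans (by norm_num)).trans hLr
  have hx : ((L : ℝ) ^ K) ^ p = Real.exp (p * ((K : ℝ) * Real.log (L : ℝ))) := by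
    rw [Real.rpow_def_of_pos (pow_pos hL0 K), Real.log_pow, mul_comm]
  have h1 : 1 + p * (K : ℝ) ≤ ((L : ℝ) ^ K) ^ p := by
    rw [hx]
    have hK : (0 : ℝ) ≤ K := Nat.cast_nonneg K
    calc 1 + p * (K : ℝ) ≤ p * ((K : ℝ) * Real.log (L : ℝ)) + 1 := by nlinarith [mul_nonneg hp.le hK]
      _ ≤ _ := Real.add_one_le_exp _
  have h2 : (1 : ℝ) ≤ ((L : ℝ) ^ K) ^ p := Real.one_le_rpow (one_le_pow₀ (by linarith)) hp.le
  have hpi : p⁻¹ * (p * (K : ℝ)) = K := by rw [← mul_assoc, inv_mul_cancel₀ hp.ne', one_mul]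
  have h3 : (K : ℝ) ≤ p⁻¹ * (((L : ℝ) ^ K) ^ p - 1) := by
    rw [← hpi]
    exact mul_le_mul_of_nonneg_left (by linarith) (inv_nonneg.mpr hp.le)
  nlinarith [inv_nonneg.mpr hp.le]

/-- THE ENTRY-2 ROW AGAINST THE COMMON RATE NUMBER: for `L ≥ 3`, `0 ≤ r ≤ r₀`, `d` and `K`,
`(K+2)·((L^K)^{−1∕4} + r·(L^K)^{−1∕(8(d+1))}) ≤ (16(d+1) + 2)(1 + r₀)·(L^K)^{−1∕(32(d+1))}`. [folklore] -/
theorem srcDivEntry_rate_le {L : ℕ} (hL : 3 ≤ L) {r r₀ : ℝ} (hr : 0 ≤ r) (hrr₀ : r ≤ r₀) (d K : ℕ) :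
    (((K : ℕ) : ℝ) + 2) * (((L : ℝ) ^ K) ^ (-((1 / 2 : ℝ) / 2)) + r * ((L ^ K : ℕ) : ℝ) ^ (-(1 / (8 * ((d : ℝ) + 1)))))
      ≤ (16 * ((d : ℝ) + 1) + 2) * (1 + r₀) * ((L : ℝ) ^ K) ^ (-(1 / (32 * ((d : ℝ) + 1)))) := by
  have hL0 : (0 : ℝ) < (L : ℝ) := by exact_mod_cast (show 0 < L by omega)
  have hx0 : (0 : ℝ) < (L : ℝ) ^ K := pow_pos hL0 K
  have hx1 : (1 : ℝ) ≤ (L : ℝ) ^ K := one_le_pow₀ (by exact_mod_cast (show 1 ≤ L by omega))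
  have hd1 : (0 : ℝ) < (d : ℝ) + 1 := by positivity
  have hp : (0 : ℝ) < 1 / (16 * ((d : ℝ) + 1)) := by positivity
  have hlev := levelCount_le_rpow hL hp K
  have hpinv : (1 / (16 * ((d : ℝ) + 1)))⁻¹ = 16 * ((d : ℝ) + 1) := by rw [one_div, inv_inv]
  rw [hpinv] at hlev
  rw [Nat.cast_pow]
  -- `(L^K)^p · (L^K)^{−1∕4} ≤ (L^K)^{−ε}`, `(L^K)^p · (L^K)^{−1∕(8(d+1))} ≤ (L^K)^{−ε}`
  have hθ : 0 ≤ ((L : ℝ) ^ K) ^ (-((1 / 2 : ℝ) / 2)) := Real.rpow_nonneg hx0.le _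
  have hxr : 0 ≤ ((L : ℝ) ^ K) ^ (-(1 / (8 * ((d : ℝ) + 1)))) := Real.rpow_nonneg hx0.le _
  have hε0 : 0 ≤ ((L : ℝ) ^ K) ^ (-(1 / (32 * ((d : ℝ) + 1)))) := Real.rpow_nonneg hx0.le _
  have e1 : ((L : ℝ) ^ K) ^ (1 / (16 * ((d : ℝ) + 1))) * ((L : ℝ) ^ K) ^ (-((1 / 2 : ℝ) / 2)) ≤ ((L : ℝ) ^ K) ^ (-(1 / (32 * ((d : ℝ) + 1)))) := by
    rw [← Real.rpow_add hx0]
    refine Real.rpow_le_rpow_of_exponent_le hx1 ?_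
    have hd0 : (0 : ℝ) ≤ d := Nat.cast_nonneg d
    have h16 : 1 / (16 * ((d : ℝ) + 1)) ≤ 1 / 16 := one_div_le_one_div_of_le (by norm_num) (by nlinarith)
    have h32 : 1 / (32 * ((d : ℝ) + 1)) ≤ 1 / 32 := one_div_le_one_div_of_le (by norm_num) (by nlinarith)
    have h32' : 0 < 1 / (32 * ((d : ℝ) + 1)) := by positivity
    linarith
  have e2 : ((L : ℝ) ^ K) ^ (1 / (16 * ((d : ℝ) + 1))) * ((L : ℝ) ^ K) ^ (-(1 / (8 * ((d : ℝ) + 1)))) ≤ ((L : ℝ) ^ K) ^ (-(1 / (32 * ((d : ℝ) + 1)))) := by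
    rw [← Real.rpow_add hx0]
    refine Real.rpow_le_rpow_of_exponent_le hx1 ?_
    have : 1 / (16 * ((d : ℝ) + 1)) - 1 / (8 * ((d : ℝ) + 1)) = -(1 / (16 * ((d : ℝ) + 1))) := by field_simp; ring
    have h' : 1 / (32 * ((d : ℝ) + 1)) ≤ 1 / (16 * ((d : ℝ) + 1)) := one_div_le_one_div_of_le (by positivity) (by nlinarith)
    linarith
  calc (((K : ℕ) : ℝ) + 2) * (((L : ℝ) ^ K) ^ (-((1 / 2 : ℝ) / 2)) + r * ((L : ℝ) ^ K) ^ (-(1 / (8 * ((d : ℝ) + 1)))))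
      ≤ ((16 * ((d : ℝ) + 1) + 2) * ((L : ℝ) ^ K) ^ (1 / (16 * ((d : ℝ) + 1)))) *
          (((L : ℝ) ^ K) ^ (-((1 / 2 : ℝ) / 2)) + r₀ * ((L : ℝ) ^ K) ^ (-(1 / (8 * ((d : ℝ) + 1))))) :=
        mul_le_mul hlev (by nlinarith) (by positivity) (by positivity)
    _ = (16 * ((d : ℝ) + 1) + 2) * ((((L : ℝ) ^ K) ^ (1 / (16 * ((d : ℝ) + 1))) * ((L : ℝ) ^ K) ^ (-((1 / 2 : ℝ) / 2))) +
          r₀ * (((L : ℝ) ^ K) ^ (1 / (16 * ((d : ℝ) + 1))) * ((L : ℝ) ^ K) ^ (-(1 / (8 * ((d : ℝ) + 1)))))) := by ring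
    _ ≤ (16 * ((d : ℝ) + 1) + 2) * (((L : ℝ) ^ K) ^ (-(1 / (32 * ((d : ℝ) + 1)))) + r₀ * ((L : ℝ) ^ K) ^ (-(1 / (32 * ((d : ℝ) + 1))))) := by
        have hr₀ : 0 ≤ r₀ := hr.trans hrr₀
        have := mul_le_mul_of_nonneg_left e2 hr₀
        nlinarith
    _ = _ := by ring

end Rates

/-! ## §2 The family with all four entries live -/

section Sized

variable (d) (L : ℕ) [NeZero L] {m0sq : ℝ}

/-- THE KERNEL FAMILY WITH ALL FOUR ENTRIES LIVE at a rung index: dag-n15-a K-D's `foKingFamilyCov` (entry 0 = values, entry 1 = the dressed gradient, entry 3 = the dressed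
covariant Laplacian `(N²Δ ⊗ 1 + V)X`) with ENTRY 2 := `𝔇_{kingPrV}(X′∘N′∇′*_κ, X̄∘N̄∇̄*_κ)`, `X = (bgPair (A₀⁻¹⊗1) (N∇_μ(A₀⁻¹⊗1))_μ c a)_none` the dressed propagator — the dressed SOURCE
DIVERGENCE, background LIVE at both spacings (coarse partner at the block-averaged letters); read through `opFamily`.
[cite: Balaban1985BackgroundPropagators, (3.42) p.397 (the four entries; third = `G∇*`), (3.52) p.400, (3.62)–(3.65) pp.402–403 (mechanism); King1986, (4.1)–(4.5) p.670, (4.36) p.674] -/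
def foKingFamilyAll (a : ℝ) (ν κ : Fin (d + 1)) (i : EtaLatIdx d m0sq) : B9.KernelFamily (foKingInstance d L i).gc (foKingInstance d L i).Bf :=
  show B9.KernelFamily (opGeo (unitTorusGeoS L i.K (EtaLatIdx.cube L i) i.Msz) (Tor (fine (L ^ i.K) (EtaLatIdx.cube L i)) × Fin (d + 1)) (blkFine L i.K (EtaLatIdx.cube L i)))
      (coeffBgFO (EtaLatIdx.cube L i) (L ^ i.n * L ^ i.K) i.Msz) from
    opFamily (g := unitTorusGeoS L i.K (EtaLatIdx.cube L i) i.Msz) (B := coeffBgFO (EtaLatIdx.cube L i) (L ^ i.n * L ^ i.K) i.Msz)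
      (blkFine L i.K (EtaLatIdx.cube L i)) (blkFine L i.K (EtaLatIdx.cube L i) ∘ kingPrV L i.K i.n (EtaLatIdx.cube L i))
      (foOps (EtaLatIdx.cube L i) i.K i.n i.Msz (tensorId (Fin (d + 1)) (kingGOp L a i.msq i.K (L ^ i.K) (EtaLatIdx.cube L i)))
        (tensorId (Fin (d + 1)) (kingGOp L a i.msq (i.K + i.n) (L ^ i.n * L ^ i.K) (EtaLatIdx.cube L i)))
        fun j U => ![
          idef (pull (kingPrV L i.K i.n (EtaLatIdx.cube L i))) (pull (kingPrV L i.K i.n (EtaLatIdx.cube L i)))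
            (projO (some ν) ∘ₗ bgPair (tensorId (Fin (d + 1)) (kingGOp L a i.msq (i.K + i.n) (L ^ i.n * L ^ i.K) (EtaLatIdx.cube L i)))
              (fun μ => symbOp (EtaLatIdx.cube L i) (L ^ i.n * L ^ i.K) (sD (EtaLatIdx.cube L i) (L ^ i.n * L ^ i.K) μ ((L ^ i.n * L ^ i.K : ℕ) : ℝ)) ∘ₗ
                tensorId (Fin (d + 1)) (kingGOp L a i.msq (i.K + i.n) (L ^ i.n * L ^ i.K) (EtaLatIdx.cube L i))) U.1 U.2)
            (projO (some ν) ∘ₗ bgPair (tensorId (Fin (d + 1)) (kingGOp L a i.msq i.K (L ^ i.K) (EtaLatIdx.cube L i)))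
              (fun μ => symbOp (EtaLatIdx.cube L i) (L ^ i.K) (sD (EtaLatIdx.cube L i) (L ^ i.K) μ ((L ^ i.K : ℕ) : ℝ)) ∘ₗ
                tensorId (Fin (d + 1)) (kingGOp L a i.msq i.K (L ^ i.K) (EtaLatIdx.cube L i)))
              (blockAvg (kingPrV L i.K i.n (EtaLatIdx.cube L i)) U.1) (fun μ => blockAvg (kingPrV L i.K i.n (EtaLatIdx.cube L i)) (U.2 μ))),
          idef (pull (kingPrV L i.K i.n (EtaLatIdx.cube L i))) (pull (kingPrV L i.K i.n (EtaLatIdx.cube L i)))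
            ((projO none ∘ₗ bgPair (tensorId (Fin (d + 1)) (kingGOp L a i.msq (i.K + i.n) (L ^ i.n * L ^ i.K) (EtaLatIdx.cube L i)))
                (fun μ => symbOp (EtaLatIdx.cube L i) (L ^ i.n * L ^ i.K) (sD (EtaLatIdx.cube L i) (L ^ i.n * L ^ i.K) μ ((L ^ i.n * L ^ i.K : ℕ) : ℝ)) ∘ₗ
                  tensorId (Fin (d + 1)) (kingGOp L a i.msq (i.K + i.n) (L ^ i.n * L ^ i.K) (EtaLatIdx.cube L i))) U.1 U.2) ∘ₗ
              symbOp (EtaLatIdx.cube L i) (L ^ i.n * L ^ i.K) (((L ^ i.n * L ^ i.K : ℕ) : ℝ) • (sTinv (EtaLatIdx.cube L i) (L ^ i.n * L ^ i.K) κ - 1)))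
            ((projO none ∘ₗ bgPair (tensorId (Fin (d + 1)) (kingGOp L a i.msq i.K (L ^ i.K) (EtaLatIdx.cube L i)))
                (fun μ => symbOp (EtaLatIdx.cube L i) (L ^ i.K) (sD (EtaLatIdx.cube L i) (L ^ i.K) μ ((L ^ i.K : ℕ) : ℝ)) ∘ₗ
                  tensorId (Fin (d + 1)) (kingGOp L a i.msq i.K (L ^ i.K) (EtaLatIdx.cube L i)))
                (blockAvg (kingPrV L i.K i.n (EtaLatIdx.cube L i)) U.1) (fun μ => blockAvg (kingPrV L i.K i.n (EtaLatIdx.cube L i)) (U.2 μ))) ∘ₗ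
              symbOp (EtaLatIdx.cube L i) (L ^ i.K) (((L ^ i.K : ℕ) : ℝ) • (sTinv (EtaLatIdx.cube L i) (L ^ i.K) κ - 1))),
          idef (pull (kingPrV L i.K i.n (EtaLatIdx.cube L i))) (pull (kingPrV L i.K i.n (EtaLatIdx.cube L i)))
            (tensorId (Fin (d + 1)) (kingLapOp L a i.msq (i.K + i.n) (L ^ i.n * L ^ i.K) (EtaLatIdx.cube L i)) ∘ₗ
                (LinearMap.id + unstack U.1 U.2 ∘ₗ bgPair (tensorId (Fin (d + 1)) (kingGOp L a i.msq (i.K + i.n) (L ^ i.n * L ^ i.K) (EtaLatIdx.cube L i)))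
                  (fun μ => symbOp (EtaLatIdx.cube L i) (L ^ i.n * L ^ i.K) (sD (EtaLatIdx.cube L i) (L ^ i.n * L ^ i.K) μ ((L ^ i.n * L ^ i.K : ℕ) : ℝ)) ∘ₗ
                    tensorId (Fin (d + 1)) (kingGOp L a i.msq (i.K + i.n) (L ^ i.n * L ^ i.K) (EtaLatIdx.cube L i))) U.1 U.2) +
              unstack U.1 U.2 ∘ₗ bgPair (tensorId (Fin (d + 1)) (kingGOp L a i.msq (i.K + i.n) (L ^ i.n * L ^ i.K) (EtaLatIdx.cube L i)))
                (fun μ => symbOp (EtaLatIdx.cube L i) (L ^ i.n * L ^ i.K) (sD (EtaLatIdx.cube L i) (L ^ i.n * L ^ i.K) μ ((L ^ i.n * L ^ i.K : ℕ) : ℝ)) ∘ₗ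
                  tensorId (Fin (d + 1)) (kingGOp L a i.msq (i.K + i.n) (L ^ i.n * L ^ i.K) (EtaLatIdx.cube L i))) U.1 U.2)
            (tensorId (Fin (d + 1)) (kingLapOp L a i.msq i.K (L ^ i.K) (EtaLatIdx.cube L i)) ∘ₗ
                (LinearMap.id + unstack (blockAvg (kingPrV L i.K i.n (EtaLatIdx.cube L i)) U.1) (fun μ => blockAvg (kingPrV L i.K i.n (EtaLatIdx.cube L i)) (U.2 μ)) ∘ₗ
                  bgPair (tensorId (Fin (d + 1)) (kingGOp L a i.msq i.K (L ^ i.K) (EtaLatIdx.cube L i)))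
                    (fun μ => symbOp (EtaLatIdx.cube L i) (L ^ i.K) (sD (EtaLatIdx.cube L i) (L ^ i.K) μ ((L ^ i.K : ℕ) : ℝ)) ∘ₗ
                      tensorId (Fin (d + 1)) (kingGOp L a i.msq i.K (L ^ i.K) (EtaLatIdx.cube L i)))
                    (blockAvg (kingPrV L i.K i.n (EtaLatIdx.cube L i)) U.1) (fun μ => blockAvg (kingPrV L i.K i.n (EtaLatIdx.cube L i)) (U.2 μ))) +
              unstack (blockAvg (kingPrV L i.K i.n (EtaLatIdx.cube L i)) U.1) (fun μ => blockAvg (kingPrV L i.K i.n (EtaLatIdx.cube L i)) (U.2 μ)) ∘ₗ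
                bgPair (tensorId (Fin (d + 1)) (kingGOp L a i.msq i.K (L ^ i.K) (EtaLatIdx.cube L i)))
                  (fun μ => symbOp (EtaLatIdx.cube L i) (L ^ i.K) (sD (EtaLatIdx.cube L i) (L ^ i.K) μ ((L ^ i.K : ℕ) : ℝ)) ∘ₗ
                    tensorId (Fin (d + 1)) (kingGOp L a i.msq i.K (L ^ i.K) (EtaLatIdx.cube L i)))
                  (blockAvg (kingPrV L i.K i.n (EtaLatIdx.cube L i)) U.1) (fun μ => blockAvg (kingPrV L i.K i.n (EtaLatIdx.cube L i)) (U.2 μ)))] j)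

end Sized

/-! ## §3 ★★★ `NE2PlusOperator` BY NAME, all four entries background-live, hypothesis-free -/

section Main

variable (d) {L : ℕ} [NeZero L] {m0sq : ℝ}

set_option maxHeartbeats 1600000 in
/-- ★★★ **NE2⁺, OPERATOR LAYER — `T4EtaRate.NE2PlusOperator` BY NAME, HYPOTHESIS-FREE, FOR KING's FULL `A = 0` PROPAGATOR `⊗ 1` DRESSED BY THE FIRST-ORDER SPECIES ON THE (3.35)-PAIR CARRIER, ALL
FOUR ENTRIES BACKGROUND-LIVE.**  For `d ≥ 1`, odd `L ≥ 3` (stated `Odd L`, `2 ≤ L`), `a > 0`, `m₀² ≥ 0`, `c₃₅ > 0`, directions `ν, κ`: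
`NE2PlusOperator c₃₅ (foKingInstance d L) (foKingFamilyAll d L a ν κ)`.  (3.35) is consumed as the sup of `c′`, `a′_μ` and of the first quotients of `a′` — NOTHING on `∇c′`; the size guard is LIVE
(cofinal family); `M_sz·α₀ ≤ a₀ = r₀∕c₃₅` drives the three Neumann series (K-B's jet, this seat's by-parts jet, K-D's); King's exponent `γ = ½`; common rate number `(L^K)^{−1∕(32(d+1))}` (§1 absorbs
the entry-2 logarithm `K + 2` and the cell-oscillation rate `(L^K)^{−1∕(8(d+1))}`). [cite: Balaban1985BackgroundPropagators, Thm 3.1 p.397 (quantifier template), (3.35) p.396, (3.42) p.397, (3.52)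
p.400, (3.62)–(3.65) pp.402–403 (shapes, mechanism); King1986, (2.13)–(2.17) p.653, Prop. 3.8 (3.71) p.664, Prop. 3.9 (3.73) p.665, (4.42) p.675] -/
theorem ne2PlusOperator_kingJet_allEntries (hd : 1 ≤ d) (hLodd : Odd L) (hL : 2 ≤ L) {a : ℝ} (ha : 0 < a) (hm0 : 0 ≤ m0sq) (c35 : ℝ) (hc35 : 0 < c35)
    (ν κ : Fin (d + 1)) : NE2PlusOperator c35 (foKingInstance d L (m0sq := m0sq)) (foKingFamilyAll d L a ν κ) := by
  -- King's rate exponent `γ := 1∕2`; the family's rate number is `(L^K)^{−ε}`, `ε = 1∕(32(d+1))`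
  have hγ0 : (0 : ℝ) ≤ 1 / 2 := by norm_num
  have hγ1 : (1 / 2 : ℝ) < 1 := by norm_num
  have hL3 : 3 ≤ L := by
    rcases hLodd with ⟨t, ht⟩
    omega
  have hL1 : (1 : ℝ) ≤ (L : ℝ) := by exact_mod_cast (show 1 ≤ L by omega)
  have hLr : (0 : ℝ) < (L : ℝ) := by positivity
  have hε : (0 : ℝ) < 1 / (32 * ((d : ℝ) + 1)) := by positivity
  -- entries 0–1: K-B; entry 2: this seat's FILE 70e; entry 3: K-D
  obtain ⟨δJ, rJ, B, hδJ, hrJ, hB, HJ⟩ := hasMaj_projO_idef_bgPair_kingJet d L hd hLodd hL ha hm0 hγ0 hγ1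
  obtain ⟨δ₄, r₄, B₄, hδ₄, hr₄, hB₄, H4⟩ := hasMaj_idef_srcDivJet_king d L hd hLodd hL ha hm0 hγ0 hγ1
  obtain ⟨δ₃, r₃, B₃, hδ₃, hr₃, hB₃, H3⟩ := hasMaj_idef_covLapJet_king d L hd hLodd hL ha hm0 hγ0 hγ1
  set r₀ : ℝ := min rJ (min r₃ r₄) with hr₀def
  have hr₀ : 0 < r₀ := lt_min hrJ (lt_min hr₃ hr₄)
  set δ₀ : ℝ := min δJ (min δ₄ δ₃) with hδ₀def
  have hδ₀ : 0 < δ₀ := lt_min hδJ (lt_min hδ₄ hδ₃)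
  set BJ : ℝ := B * (1 + 2 * r₀ + 2 * ((d : ℝ) + 1) * r₀) with hBJdef
  have hBJ : 0 < BJ := by positivity
  set BS : ℝ := B₄ * ((16 * ((d : ℝ) + 1) + 2) * (1 + r₀)) with hBSdef
  have hBS : 0 < BS := by positivity
  set BC : ℝ := B₃ * (1 + 2 * r₀ + 2 * ((d : ℝ) + 1) * r₀) with hBCdef
  have hBC : 0 < BC := by positivity
  set B₀ : ℝ := BJ + BS + BC with hB₀def
  have hB₀ : 0 < B₀ := by positivity
  refine ⟨1, δ₀, r₀ / c35, B₀, 1 / (32 * ((d : ℝ) + 1)), one_pos, hδ₀, by positivity, hB₀, hε, fun i _hM α₀ hα₀ hMα U hU => ?_⟩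
  -- at the index `i`: the letters of the configuration
  obtain ⟨hU1, hU2, hU3⟩ := (reg335_coeffBgFO_iff (EtaLatIdx.cube L i) (L ^ i.n * L ^ i.K) i.Msz c35 α₀ U).1 hU
  have hMsz : (0 : ℝ) ≤ i.Msz := zero_le_one.trans i.one_le_Msz
  have hr0 : 0 ≤ c35 * i.Msz * α₀ := by positivity
  have hrr₀ : c35 * i.Msz * α₀ ≤ r₀ := by
    have h := mul_le_mul_of_nonneg_left hMα hc35.le
    rw [foKingInstance_gf_M, mul_div_cancel₀ _ hc35.ne'] at h
    linarith [h]
  have hn' : (0 : ℝ) < ((L ^ i.n * L ^ i.K : ℕ) : ℝ) := by positivity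
  have hfa : ∀ μ' z, |U.2 μ' z - blockAvg (kingPrV L i.K i.n (EtaLatIdx.cube L i)) (U.2 μ') (kingPrV L i.K i.n (EtaLatIdx.cube L i) z)| ≤
      ((2 * ((d + 1) * (L ^ i.n - 1)) : ℕ) : ℝ) * (c35 * i.Msz * α₀ / ((L ^ i.n * L ^ i.K : ℕ) : ℝ)) :=
    fun μ' z => fit_blockAvg _ (fibreOsc_of_fgrad L i.K i.n (EtaLatIdx.cube L i) hn' fun κ' z => hU3 μ' κ' z) z
  have hoa : 0 ≤ ((2 * ((d + 1) * (L ^ i.n - 1)) : ℕ) : ℝ) * (c35 * i.Msz * α₀ / ((L ^ i.n * L ^ i.K : ℕ) : ℝ)) := by positivity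
  have hJ := HJ i.K i.one_le_K i.n i.one_le_n i.e (EtaLatIdx.cube L i) (fun _ => rfl) i.msq i.msq_pos i.msq_le _ hr0 (hrr₀.trans (min_le_left _ _)) _ hoa U.1 U.2 hU1 hU2 hfa
  have hS := H4 i.K i.one_le_K i.n i.one_le_n i.e (EtaLatIdx.cube L i) (fun _ => rfl) i.msq i.msq_pos i.msq_le κ _ hr0
    (hrr₀.trans ((min_le_right _ _).trans (min_le_right _ _))) U.1 U.2 hU1 hU2 hU3
  have hC := H3 i.K i.one_le_K i.n i.one_le_n i.e (EtaLatIdx.cube L i) (fun _ => rfl) i.msq i.msq_pos i.msq_le _ hr0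
    (hrr₀.trans ((min_le_right _ _).trans (min_le_left _ _))) _ hoa U.1 U.2 hU1 hU2 hfa
  -- the readout
  have hη : 0 < (unitTorusGeoS L i.K (EtaLatIdx.cube L i) i.Msz).eta := inv_pos.mpr (pow_pos hLr _)
  have hblk : blkFine L i.K (EtaLatIdx.cube L i) ∘ kingPrV L i.K i.n (EtaLatIdx.cube L i) =
      fun j : Tor (fine (L ^ i.n * L ^ i.K) (EtaLatIdx.cube L i)) × Fin (d + 1) => blockOf (L ^ i.n * L ^ i.K) (EtaLatIdx.cube L i) j.1 :=
    blkFine_comp_kingPrV (EtaLatIdx.cube L i) L i.K i.n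
  unfold foKingFamilyAll
  rw [hblk]
  -- the common rate number and the absorptions
  have hx0 : (0 : ℝ) < (L : ℝ) ^ i.K := pow_pos hLr _
  have hθ : 0 ≤ ((L : ℝ) ^ i.K) ^ (-((1 / 2 : ℝ) / 2)) := Real.rpow_nonneg hx0.le _
  have hx1 : (1 : ℝ) ≤ (L : ℝ) ^ i.K := one_le_pow₀ hL1
  have hεθ : ((L : ℝ) ^ i.K) ^ (-((1 / 2 : ℝ) / 2)) ≤ ((L : ℝ) ^ i.K) ^ (-(1 / (32 * ((d : ℝ) + 1)))) := by
    refine Real.rpow_le_rpow_of_exponent_le hx1 (neg_le_neg ?_)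
    rw [div_le_iff₀ (by positivity)]
    have : (0 : ℝ) ≤ d := Nat.cast_nonneg d
    nlinarith
  have hhalf : ((L : ℝ) ^ i.K) ^ (-(1 / 2 : ℝ)) ≤ ((L : ℝ) ^ i.K) ^ (-((1 / 2 : ℝ) / 2)) := Real.rpow_le_rpow_of_exponent_le hx1 (by norm_num)
  have hlev : (c35 * i.Msz * α₀) * ((((i.K : ℕ) : ℝ) + 2) / (L : ℝ) ^ i.K) ≤ 2 * r₀ * ((L : ℝ) ^ i.K) ^ (-((1 / 2 : ℝ) / 2)) := by
    calc (c35 * i.Msz * α₀) * ((((i.K : ℕ) : ℝ) + 2) / (L : ℝ) ^ i.K) ≤ r₀ * (2 * ((L : ℝ) ^ i.K) ^ (-(1 / 2 : ℝ))) :=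
          mul_le_mul hrr₀ (levelCount_rate_le hL3 i.K) (div_nonneg (by positivity) (pow_nonneg hLr.le _)) hr₀.le
      _ ≤ r₀ * (2 * ((L : ℝ) ^ i.K) ^ (-((1 / 2 : ℝ) / 2))) := mul_le_mul_of_nonneg_left (by linarith) hr₀.le
      _ = 2 * r₀ * ((L : ℝ) ^ i.K) ^ (-((1 / 2 : ℝ) / 2)) := by ring
  have hosc := osc_rate_le (d := d) i.K i.n hL1 (γ := (1 / 2 : ℝ) / 2) hr0 hrr₀ (by norm_num)
  have hsum : ((L : ℝ) ^ i.K) ^ (-((1 / 2 : ℝ) / 2)) + (c35 * i.Msz * α₀) * ((((i.K : ℕ) : ℝ) + 2) / (L : ℝ) ^ i.K) +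
      ((2 * ((d + 1) * (L ^ i.n - 1)) : ℕ) : ℝ) * (c35 * i.Msz * α₀ / ((L ^ i.n * L ^ i.K : ℕ) : ℝ)) ≤
        (1 + 2 * r₀ + 2 * ((d : ℝ) + 1) * r₀) * ((L : ℝ) ^ i.K) ^ (-(1 / (32 * ((d : ℝ) + 1)))) := by
    have hr₀' : 0 ≤ 1 + 2 * r₀ + 2 * ((d : ℝ) + 1) * r₀ := by positivity
    nlinarith [hlev, hosc, mul_le_mul_of_nonneg_left hεθ hr₀']
  have hrw : ∀ y' : Tor (EtaLatIdx.cube L i), rateWeight (unitTorusGeoS L i.K (EtaLatIdx.cube L i) i.Msz) (1 / (32 * ((d : ℝ) + 1))) y' =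
      ((L : ℝ) ^ i.K) ^ (-(1 / (32 * ((d : ℝ) + 1)))) :=
    fun y' => rateWeight_unitTorusGeoS L (EtaLatIdx.cube L i) i.K i.Msz (1 / (32 * ((d : ℝ) + 1))) y'
  have hexp : ∀ {t : ℝ} (y y' : Tor (EtaLatIdx.cube L i)), δ₀ ≤ t →
      Real.exp (-(t * tdistT (EtaLatIdx.cube L i) y y')) ≤ Real.exp (-(δ₀ * tdistT (EtaLatIdx.cube L i) y y')) :=
    fun y y' ht => Real.exp_le_exp.mpr (by nlinarith [tdistT_nonneg (EtaLatIdx.cube L i) y y'])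
  have hδ₀J : δ₀ ≤ δJ := min_le_left _ _
  have hδ₀4 : δ₀ ≤ δ₄ := (min_le_right _ _).trans (min_le_left _ _)
  have hδ₀3 : δ₀ ≤ δ₃ := (min_le_right _ _).trans (min_le_right _ _)
  -- absorption of `B·(θ + r t + o_a)·e^{−δ_x d}` (entries 0, 1, 3)
  have habs : ∀ {T : (Tor (fine (L ^ i.K) (EtaLatIdx.cube L i)) × Fin (d + 1) → ℝ) →ₗ[ℝ] (Tor (fine (L ^ i.n * L ^ i.K) (EtaLatIdx.cube L i)) × Fin (d + 1) → ℝ)} {Bx δx : ℝ},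
      0 ≤ Bx → δ₀ ≤ δx →
      HasMaj (BlockNorm.ofBlocks (unitTorusGeoS L i.K (EtaLatIdx.cube L i) i.Msz) (blkFine L i.K (EtaLatIdx.cube L i)))
        (BlockNorm.ofBlocks (unitTorusGeoS L i.K (EtaLatIdx.cube L i) i.Msz) (fun j' : Tor (fine (L ^ i.n * L ^ i.K) (EtaLatIdx.cube L i)) × Fin (d + 1) => blockOf (L ^ i.n * L ^ i.K) (EtaLatIdx.cube L i) j'.1))
        T (fun y y' => Bx * (((L : ℝ) ^ i.K) ^ (-((1 / 2 : ℝ) / 2)) + c35 * i.Msz * α₀ * ((((i.K : ℕ) : ℝ) + 2) / (L : ℝ) ^ i.K) +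
            ((2 * ((d + 1) * (L ^ i.n - 1)) : ℕ) : ℝ) * (c35 * i.Msz * α₀ / ((L ^ i.n * L ^ i.K : ℕ) : ℝ))) * Real.exp (-(δx * tdistT (EtaLatIdx.cube L i) y y'))) →
      HasMaj (BlockNorm.ofBlocks (unitTorusGeoS L i.K (EtaLatIdx.cube L i) i.Msz) (blkFine L i.K (EtaLatIdx.cube L i)))
        (BlockNorm.ofBlocks (unitTorusGeoS L i.K (EtaLatIdx.cube L i) i.Msz) (fun j' : Tor (fine (L ^ i.n * L ^ i.K) (EtaLatIdx.cube L i)) × Fin (d + 1) => blockOf (L ^ i.n * L ^ i.K) (EtaLatIdx.cube L i) j'.1))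
        T (fun y y' => Bx * (1 + 2 * r₀ + 2 * ((d : ℝ) + 1) * r₀) * Real.exp (-(δ₀ * tdistT (EtaLatIdx.cube L i) y y')) *
          rateWeight (unitTorusGeoS L i.K (EtaLatIdx.cube L i) i.Msz) (1 / (32 * ((d : ℝ) + 1))) y') := by
    intro T Bx δx hBx hδx h
    refine h.mono fun y y' => ?_
    rw [hrw]
    have hE := Real.exp_nonneg (-(δx * tdistT (EtaLatIdx.cube L i) y y'))
    have hε0 : 0 ≤ ((L : ℝ) ^ i.K) ^ (-(1 / (32 * ((d : ℝ) + 1)))) := Real.rpow_nonneg hx0.le _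
    calc Bx * (((L : ℝ) ^ i.K) ^ (-((1 / 2 : ℝ) / 2)) + c35 * i.Msz * α₀ * ((((i.K : ℕ) : ℝ) + 2) / (L : ℝ) ^ i.K) +
            ((2 * ((d + 1) * (L ^ i.n - 1)) : ℕ) : ℝ) * (c35 * i.Msz * α₀ / ((L ^ i.n * L ^ i.K : ℕ) : ℝ))) * Real.exp (-(δx * tdistT (EtaLatIdx.cube L i) y y'))
        ≤ Bx * ((1 + 2 * r₀ + 2 * ((d : ℝ) + 1) * r₀) * ((L : ℝ) ^ i.K) ^ (-(1 / (32 * ((d : ℝ) + 1))))) * Real.exp (-(δ₀ * tdistT (EtaLatIdx.cube L i) y y')) :=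
          mul_le_mul (mul_le_mul_of_nonneg_left hsum hBx) (hexp y y' hδx) hE (by positivity)
      _ = Bx * (1 + 2 * r₀ + 2 * ((d : ℝ) + 1) * r₀) * Real.exp (-(δ₀ * tdistT (EtaLatIdx.cube L i) y y')) * ((L : ℝ) ^ i.K) ^ (-(1 / (32 * ((d : ℝ) + 1)))) := by ring
  have hjet := fun j => habs hB.le hδ₀J (hJ j)
  have h3c := habs hB₃.le hδ₀3 hC
  -- absorption of the entry-2 row `B₄(K+2)(θ + r·x)e^{−δ₄ d}` (§1)
  have hrate := srcDivEntry_rate_le hL3 hr0 hrr₀ d i.K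
  refine etaRateIneq342_of_hasMaj_rateWeight (g := unitTorusGeoS L i.K (EtaLatIdx.cube L i) i.Msz) (B := coeffBgFO (EtaLatIdx.cube L i) (L ^ i.n * L ^ i.K) i.Msz)
    (blkFine L i.K (EtaLatIdx.cube L i)) (fun j : Tor (fine (L ^ i.n * L ^ i.K) (EtaLatIdx.cube L i)) × Fin (d + 1) => blockOf (L ^ i.n * L ^ i.K) (EtaLatIdx.cube L i) j.1)
    hη hLr hB₀.le (c := ![BJ, BJ, BS, BC]) (fun n => by fin_cases n <;> simp <;> positivity) (fun n y => ?_) _ U fun n => ?_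
  · -- `c n ≤ B₀ ≤ B₀·pref4`
    have hlen : 1 ≤ (unitTorusGeoS L i.K (EtaLatIdx.cube L i) i.Msz).len y := by
      show (1 : ℝ) ≤ (L : ℝ) ^ i.K * (((L : ℝ) ^ i.K)⁻¹)
      rw [mul_inv_cancel₀ (pow_ne_zero _ hLr.ne')]
    have hpref := one_le_pref4 hlen n
    have hcn : (![BJ, BJ, BS, BC] : Fin 4 → ℝ) n ≤ B₀ := by
      fin_cases n
      · show BJ ≤ B₀; rw [hB₀def]; linarith
      · show BJ ≤ B₀; rw [hB₀def]; linarith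
      · show BS ≤ B₀; rw [hB₀def]; linarith
      · show BC ≤ B₀; rw [hB₀def]; linarith
    calc _ ≤ B₀ := hcn
      _ = B₀ * 1 := (mul_one _).symm
      _ ≤ _ := mul_le_mul_of_nonneg_left hpref hB₀.le
  · fin_cases n
    · exact hjet none
    · exact hjet (some ν)
    · refine hS.mono fun y y' => ?_
      show _ ≤ BS * Real.exp (-(δ₀ * tdistT (EtaLatIdx.cube L i) y y')) * rateWeight (unitTorusGeoS L i.K (EtaLatIdx.cube L i) i.Msz) (1 / (32 * ((d : ℝ) + 1))) y'
      rw [hrw]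
      have hE := Real.exp_nonneg (-(δ₄ * tdistT (EtaLatIdx.cube L i) y y'))
      have hε0 : 0 ≤ ((L : ℝ) ^ i.K) ^ (-(1 / (32 * ((d : ℝ) + 1)))) := Real.rpow_nonneg hx0.le _
      calc B₄ * (((i.K : ℕ) : ℝ) + 2) * (((L : ℝ) ^ i.K) ^ (-((1 / 2 : ℝ) / 2)) + c35 * i.Msz * α₀ * ((L ^ i.K : ℕ) : ℝ) ^ (-(1 / (8 * ((d : ℝ) + 1))))) *
            Real.exp (-(δ₄ * tdistT (EtaLatIdx.cube L i) y y'))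
          = B₄ * ((((i.K : ℕ) : ℝ) + 2) * (((L : ℝ) ^ i.K) ^ (-((1 / 2 : ℝ) / 2)) + c35 * i.Msz * α₀ * ((L ^ i.K : ℕ) : ℝ) ^ (-(1 / (8 * ((d : ℝ) + 1)))))) *
            Real.exp (-(δ₄ * tdistT (EtaLatIdx.cube L i) y y')) := by ring
        _ ≤ B₄ * ((16 * ((d : ℝ) + 1) + 2) * (1 + r₀) * ((L : ℝ) ^ i.K) ^ (-(1 / (32 * ((d : ℝ) + 1))))) *
            Real.exp (-(δ₀ * tdistT (EtaLatIdx.cube L i) y y')) :=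
          mul_le_mul (mul_le_mul_of_nonneg_left hrate hB₄.le) (hexp y y' hδ₀4) hE (by positivity)
        _ = BS * Real.exp (-(δ₀ * tdistT (EtaLatIdx.cube L i) y y')) * ((L : ℝ) ^ i.K) ^ (-(1 / (32 * ((d : ℝ) + 1)))) := by rw [hBSdef]; ring
    · exact h3c

/-- ★★ **NE2⁰ FOR THE SAME FAMILY — `T4EtaRate.NE2ZeroOperator` BY NAME**: the trivial family `U = 0` is regular for every `α₀ > 0` under the guard, so `ne2Zero_of_ne2Plus` applies.
[cite: King1986, Props. 3.8–3.9 (3.71)–(3.75) pp.664–665 (A = 0 model); Balaban1985BackgroundPropagators, Thm 3.1 p.397 (quantifier template)] -/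
theorem ne2ZeroOperator_kingJet_allEntries (hd : 1 ≤ d) (hLodd : Odd L) (hL : 2 ≤ L) {a : ℝ} (ha : 0 < a) (hm0 : 0 ≤ m0sq) {c35 : ℝ} (hc35 : 0 < c35) (ν κ : Fin (d + 1)) :
    NE2ZeroOperator (foKingInstance d L (m0sq := m0sq)) (foKingFamilyAll d L a ν κ) := by
  refine ne2Zero_of_ne2Plus (c35 := c35) (fun i α₀ hα₀ => ?_) (ne2PlusOperator_kingJet_allEntries d hd hLodd hL ha hm0 c35 hc35 ν κ)
  have hM : (0 : ℝ) ≤ i.Msz := zero_le_one.trans i.one_le_Msz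
  have h0 : (0 : ℝ) ≤ c35 * i.Msz * α₀ := by positivity
  refine (reg335_coeffBgFO_iff (EtaLatIdx.cube L i) (L ^ i.n * L ^ i.K) i.Msz c35 α₀ _).2 ⟨fun z => ?_, fun μ' z => ?_, fun μ' κ' z => ?_⟩
  · show |(0 : ℝ)| ≤ _; rw [abs_zero]; exact h0
  · show |(0 : ℝ)| ≤ _; rw [abs_zero]; exact h0
  · rw [fgrad_apply]
    show |((L ^ i.n * L ^ i.K : ℕ) : ℝ) * ((0 : ℝ) - 0)| ≤ _
    rw [sub_zero, mul_zero, abs_zero]; exact h0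

/-- `d + 1 = 4`: the physical lattice dimension (King's model on `𝕋⁴_ε`; [B9]'s `d = 4`). [cite: King1986, p.653 (d + 1 = 4); Balaban1985BackgroundPropagators, Thm 3.1 p.397] -/
theorem ne2PlusOperator_kingJet_allEntries_dim4 (hLodd : Odd L) (hL : 2 ≤ L) {a : ℝ} (ha : 0 < a) (hm0 : 0 ≤ m0sq) (c35 : ℝ) (hc35 : 0 < c35) (ν κ : Fin (3 + 1)) :
    NE2PlusOperator c35 (foKingInstance 3 L (m0sq := m0sq)) (foKingFamilyAll 3 L a ν κ) :=
  ne2PlusOperator_kingJet_allEntries 3 (by norm_num) hLodd hL ha hm0 c35 hc35 ν κ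

end Main

end Summit.QuantumFields.YangMills.BalabanUVNodes.N15.KingModel.SrcDiv

end
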